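import Mathlib.Combinatorics.SetFamily.FourFunctions
import Mathlib.Analysis.SpecialFunctions.Pow.Real
import Mathlib.Tactic
import HarnessLib

/-!
# FKG on the grid `[0,n) × {0,1}` from adjacent TP₂ squares

Support file for the Sahi / Conjecture-P programme of route `PercNearOneGluingNoHeavy`
(`--supports stmt-CriticalPhenomena-4575`, prover prim-l12-p5 gen 24; proof note
`prim-l12-p5/FRESH-CYCLE-g24.md` §6, Theorem C1, step (L) + FKG).  Companion of
`…LowerTailSpecialPointGrid` (the TP₂ squares themselves).  No definitions, no named facts, no sorries.

For a law `μ` on the product of a finite chain and the two-element chain, log-supermodularity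
(the hypothesis of the FKG inequality, Mathlib `fkg`) reduces to the comparison of the two rows,
`μ(i,1) μ(j,0) ≤ μ(i,0) μ(j,1)` for `i ≤ j` (`lsm_of_rowRatio`), which in turn telescopes from the
ADJACENT squares `μ(i,1) μ(i+1,0) ≤ μ(i,0) μ(i+1,1)` when `μ > 0` (`rowRatio_of_adjacent`).
`grid_fkg` packages the consequence: monotone observables are positively correlated.  In Theorem C1
this is applied (after reversing both coordinates) to `G = 1 + κ(complement)` and the fibre average
of a down-set indicator, giving GC-FINER for exchangeable-plus-one-point pattern laws.
-/

namespace Summit.CriticalPhenomena.PercolationContinuityZ3.Theorems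

namespace SpecialPointGrid

open Finset

/-- Telescoping: if `m > 0` on `[0,n) × {0,1}` and every adjacent square is TP₂,
`m i 1 * m (i+1) 0 ≤ m i 0 * m (i+1) 1`, then `m i 1 * m j 0 ≤ m i 0 * m j 1` for all `i ≤ j < n`. -/
theorem rowRatio_of_adjacent (n : ℕ) (m : ℕ → ℕ → ℝ) (hpos : ∀ i e, i < n → 0 < m i e)
    (hadj : ∀ i, i + 1 < n → m i 1 * m (i + 1) 0 ≤ m i 0 * m (i + 1) 1) :
    ∀ i j, i ≤ j → j < n → m i 1 * m j 0 ≤ m i 0 * m j 1 := by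
  intro i j hij hjn
  induction j, hij using Nat.le_induction with
  | base => exact le_of_eq (by ring)
  | succ j hij ih =>
    have ih' := ih (by omega)
    have ha := hadj j hjn
    -- m i 1 * m (j+1) 0 * m j 1 ≤ m i 1 * m j 0 * m (j+1) 1 ... combine through the positive m j 0, m j 1
    have hj0 := hpos j 0 (by omega)
    have hj1 := hpos j 1 (by omega)
    have h1 : m i 1 * m (j + 1) 0 * m j 1 ≤ m i 0 * m (j + 1) 1 * m j 1 := by
      have e1 : m i 1 * m (j + 1) 0 * m j 1 = (m i 1 * m j 1) * m (j + 1) 0 := by ring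
      nlinarith [mul_le_mul_of_nonneg_right ih' (hpos (j + 1) 0 hjn).le,
        mul_le_mul_of_nonneg_left ha (hpos i 1 (by omega)).le,
        mul_le_mul_of_nonneg_left ha (hpos i 0 (by omega)).le, hj0, hj1]
    exact le_of_mul_le_mul_right h1 hj1

/-- On `Fin n × Fin 2`, the row comparison `μ(i,1) μ(j,0) ≤ μ(i,0) μ(j,1)` (`i ≤ j`) is exactly
log-supermodularity `μ a μ b ≤ μ (a ⊓ b) μ (a ⊔ b)`. -/
theorem lsm_of_rowRatio {n : ℕ} (μ : Fin n × Fin 2 → ℝ)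
    (h : ∀ i j : Fin n, i ≤ j → μ (i, 1) * μ (j, 0) ≤ μ (i, 0) * μ (j, 1)) :
    ∀ a b, μ a * μ b ≤ μ (a ⊓ b) * μ (a ⊔ b) := by
  rintro ⟨i, e⟩ ⟨j, e'⟩
  rcases le_total i j with hij | hji
  · fin_cases e <;> fin_cases e'
    · simp [Prod.mk_inf_mk, Prod.mk_sup_mk, inf_of_le_left hij, sup_of_le_right hij]
    · simp [Prod.mk_inf_mk, Prod.mk_sup_mk, inf_of_le_left hij, sup_of_le_right hij]
    · simp only [Prod.mk_inf_mk, Prod.mk_sup_mk, inf_of_le_left hij, sup_of_le_right hij]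
      have e1 : ((1 : Fin 2) ⊓ 0) = 0 := by decide
      have e2 : ((1 : Fin 2) ⊔ 0) = 1 := by decide
      simp only [Fin.mk_one, Fin.zero_eta, Fin.isValue] at *
      rw [e1, e2]
      exact h i j hij
    · simp [Prod.mk_inf_mk, Prod.mk_sup_mk, inf_of_le_left hij, sup_of_le_right hij]
  · fin_cases e <;> fin_cases e'
    · simp only [Prod.mk_inf_mk, Prod.mk_sup_mk, inf_of_le_right hji, sup_of_le_left hji]
      simp only [Fin.zero_eta, Fin.isValue] at *
      rw [inf_idem, sup_idem, mul_comm]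
    · simp only [Prod.mk_inf_mk, Prod.mk_sup_mk, inf_of_le_right hji, sup_of_le_left hji]
      have e1 : ((0 : Fin 2) ⊓ 1) = 0 := by decide
      have e2 : ((0 : Fin 2) ⊔ 1) = 1 := by decide
      simp only [Fin.mk_one, Fin.zero_eta, Fin.isValue] at *
      rw [e1, e2, mul_comm (μ (i, 0))]
      exact h j i hji
    · simp [Prod.mk_inf_mk, Prod.mk_sup_mk, inf_of_le_right hji, sup_of_le_left hji, mul_comm]
    · simp [Prod.mk_inf_mk, Prod.mk_sup_mk, inf_of_le_right hji, sup_of_le_left hji, mul_comm]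

/-- **FKG on the grid.**  If `m > 0` on `[0,n) × {0,1}` has TP₂ adjacent squares and `f, g` are
nonnegative and monotone on `Fin n × Fin 2` (product order), then with `μ (i,e) := m i e`:
`(∑ μ f)(∑ μ g) ≤ (∑ μ)(∑ μ f g)` — monotone observables are positively correlated. -/
theorem grid_fkg (n : ℕ) (m : ℕ → ℕ → ℝ) (hpos : ∀ i e, i < n → 0 < m i e)
    (hadj : ∀ i, i + 1 < n → m i 1 * m (i + 1) 0 ≤ m i 0 * m (i + 1) 1)
    (f g : Fin n × Fin 2 → ℝ) (hf₀ : 0 ≤ f) (hg₀ : 0 ≤ g) (hf : Monotone f) (hg : Monotone g) :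
    (∑ a : Fin n × Fin 2, m a.1.val a.2.val * f a) * ∑ a : Fin n × Fin 2, m a.1.val a.2.val * g a ≤
      (∑ a : Fin n × Fin 2, m a.1.val a.2.val) *
        ∑ a : Fin n × Fin 2, m a.1.val a.2.val * (f a * g a) := by
  set μ : Fin n × Fin 2 → ℝ := fun a => m a.1.val a.2.val with hμ
  have hμ₀ : 0 ≤ μ := fun a => (hpos a.1.val a.2.val a.1.isLt).le
  have hrow : ∀ i j : Fin n, i ≤ j → μ (i, 1) * μ (j, 0) ≤ μ (i, 0) * μ (j, 1) := by
    intro i j hij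
    simp only [hμ, Fin.isValue, Fin.val_one, Fin.val_zero]
    exact rowRatio_of_adjacent n m hpos hadj i.val j.val hij j.isLt
  exact fkg f g μ hμ₀ hf₀ hg₀ hf hg (lsm_of_rowRatio μ hrow)

end SpecialPointGrid

end Summit.CriticalPhenomena.PercolationContinuityZ3.Theorems
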